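import Summits.RiemannHypothesis.RiemannHypothesis.Theorems.ScrewChristoffelBound
import HarnessLib

/-!
# The Christoffel law of the screw Gram chain, III: `λ_M(γ)` is NON-INCREASING in `M` for every real `γ` (RH-FREE; EM-3c)

LINE 1 — LABEL: §1–§3 are RH-FREE linear algebra about the explicit nested Gram matrices `S_M = IntegerScrew.screwMatrix (M−1)`
(no zeros of `ζ` enter); §4 combines them with EM-3's RH-CONSEQUENCE floor (binder `RiemannHypothesis →` never dropped).
bears_on: LADDER-RH B-D → B-P (cell rh-dbr, seat rh-dbr-eng-5 «E_M from H_M»; D-0040 rung 3 «prove the results of the data» for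
this seat's EM-1/EM-2 table: «λ_M(γ_1) − 1 = 1.28, 0.437, 0.136, 0.0424, 0.01255 for M = 8, 16, 32, 64, 128; ÷ ≈ 3.2 per doubling»,
HOME/DATA.md §EM-1/§EM-2 Q7). WHAT THIS IS NOT: progress toward RH; the monotonicity is a property of ANY nested family of
positive definite Gram matrices; the value of the limit (`= m(ρ₀)` iff a completeness statement) is NOT claimed.

Objects (tree; nothing defined here): `S_M`, the frequency vectors `c_i = cos(γ log(i+2)) − 1`, `s_i = sin(γ log(i+2))` and the
Christoffel reading `K_M(γ,γ) = cᵀS_M⁻¹c + sᵀS_M⁻¹s` (`λ_M(γ) = γ²/K_M(γ,γ)`), as in `Theorems.ScrewChristoffelBound` (EM-3).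

* §1 RH-FREE variational characterisation: for `S ≻ 0`, `2 y·v − yᵀSy ≤ vᵀS⁻¹v` for every `y`, with equality at `y = S⁻¹v`
  (`two_mul_dotProduct_sub_le`, `dotProduct_inv_mulVec_eq_sub`).
* §2 RH-FREE monotonicity under bordering: for `S' ≻ 0` and its leading block `S = S'|_{n×n}`, `vᵀS⁻¹v ≤ v'ᵀS'⁻¹v'` when
  `v = v'|_n` (extend the optimiser by zero) (`dotProduct_inv_mulVec_submatrix_le`).
* §3 THE DATA LAW, RH-FREE: for `n ≤ N` with `S_{N+1} ≻ 0`, **`K_{n+1}(γ,γ) ≤ K_{N+1}(γ,γ)` for every real `γ`**, i.e.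
  `λ_M(γ)` is non-increasing in `M` on the positive-definite range (kernel theorem: `M ≤ 128`; under RH: all `M`)
  (`christoffel_mono`).
* §4 with EM-3: under RH (and `S_M ≻ 0 ∀M`, itself RH) the readings `K_M(γ₀,γ₀)` at a zero ordinate increase to a limit
  `L ≤ γ₀²/m(ρ₀)` — `λ_M(γ₀) ↓ γ₀²/L ≥ m(ρ₀)` (`christoffel_tendsto_of_riemannHypothesis`). Whether `L = γ₀²/m(ρ₀)` (EM-2 Q7's
  `λ_M − 1 ≈ M^{−1.7} → 0`) is a completeness statement about `{m^{iγ} − 1}` in `L²(dμ_ζ)` — NOT claimed here.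

References: P. Nevai, «Géza Freud, orthogonal polynomials and Christoffel functions. A case study», J. Approx. Theory 48 (1986) §4.1
(monotonicity and extremal property of Christoffel functions); M. Suzuki, J. Lond. Math. Soc. (2) 108 (2023), (1.4).
-/

-- `Summit.RiemannHypothesis.RiemannHypothesis.…` duplicates `RiemannHypothesis` BY DESIGN (D-0017).
set_option linter.dupNamespace false

noncomputable section

open Finset Matrix Filter
open scoped BigOperators Topology

namespace Summit.RiemannHypothesis.RiemannHypothesis.Theorems.ScrewChristoffel

open Literature.NumberTheory.LFunctions Literature.NumberTheory.LFunctions.ZetaZeros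
open Summit.RiemannHypothesis.RiemannHypothesis.Theorems.IntegerScrew

/-! ## §1 RH-FREE: the variational characterisation of `vᵀ S⁻¹ v` -/

section Generic

variable {n : Type*} [Fintype n] [DecidableEq n] {S : Matrix n n ℝ}

omit [DecidableEq n] in
/-- For a real symmetric matrix, `u ⬝ (S y) = y ⬝ (S u)`. [folklore] -/
theorem dotProduct_mulVec_comm_of_isHermitian (hS : S.IsHermitian) (u y : n → ℝ) :
    u ⬝ᵥ (S *ᵥ y) = y ⬝ᵥ (S *ᵥ u) := by
  have hT : Sᵀ = S := by
    have h := hS.eq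
    rwa [conjTranspose_eq_transpose_of_trivial] at h
  rw [dotProduct_mulVec, ← mulVec_transpose, hT, dotProduct_comm]

/-- For `S ≻ 0`, `S (S⁻¹ v) = v`. [folklore] -/
theorem mulVec_inv_mulVec (hS : S.PosDef) (v : n → ℝ) : S *ᵥ (S⁻¹ *ᵥ v) = v := by
  rw [mulVec_mulVec, mul_nonsing_inv S ((Matrix.isUnit_iff_isUnit_det S).1 hS.isUnit), one_mulVec]

/-- **Variational upper bound (completing the square)**: for `S ≻ 0` and all `y`, `2 y·v − yᵀ S y ≤ vᵀ S⁻¹ v`. RH-FREE.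
[folklore] -/
theorem two_mul_dotProduct_sub_le (hS : S.PosDef) (v y : n → ℝ) :
    2 * (y ⬝ᵥ v) - y ⬝ᵥ (S *ᵥ y) ≤ v ⬝ᵥ (S⁻¹ *ᵥ v) := by
  set u : n → ℝ := S⁻¹ *ᵥ v with hu
  have hSu : S *ᵥ u = v := mulVec_inv_mulVec hS v
  have h0 : 0 ≤ (y - u) ⬝ᵥ (S *ᵥ (y - u)) := by
    have h := hS.posSemidef.dotProduct_mulVec_nonneg (y - u)
    rwa [star_trivial] at h
  have hexp : (y - u) ⬝ᵥ (S *ᵥ (y - u)) =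
      y ⬝ᵥ (S *ᵥ y) - y ⬝ᵥ (S *ᵥ u) - u ⬝ᵥ (S *ᵥ y) + u ⬝ᵥ (S *ᵥ u) := by
    rw [mulVec_sub, sub_dotProduct, dotProduct_sub, dotProduct_sub]
    ring
  have h1 : u ⬝ᵥ (S *ᵥ y) = y ⬝ᵥ (S *ᵥ u) := dotProduct_mulVec_comm_of_isHermitian hS.1 u y
  have h2 : u ⬝ᵥ (S *ᵥ u) = v ⬝ᵥ u := by rw [hSu, dotProduct_comm]
  rw [hexp, h1, h2, hSu] at h0
  linarith

/-- … with equality at the optimiser `y = S⁻¹ v`: `vᵀ S⁻¹ v = 2 (S⁻¹v)·v − (S⁻¹v)ᵀ S (S⁻¹v)`. RH-FREE. [folklore] -/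
theorem dotProduct_inv_mulVec_eq_sub (hS : S.PosDef) (v : n → ℝ) :
    v ⬝ᵥ (S⁻¹ *ᵥ v) = 2 * ((S⁻¹ *ᵥ v) ⬝ᵥ v) - (S⁻¹ *ᵥ v) ⬝ᵥ (S *ᵥ (S⁻¹ *ᵥ v)) := by
  rw [mulVec_inv_mulVec hS v, dotProduct_comm (S⁻¹ *ᵥ v) v]
  ring

end Generic

/-! ## §2 RH-FREE: monotonicity of `vᵀ S⁻¹ v` under bordering (leading blocks) -/

section Border

variable {n N : ℕ} (h : n ≤ N)

/-- Sums against the extension by zero `j ↦ u ⟨j, _⟩ (j < n), 0 (j ≥ n)` reduce to the leading block. [folklore] -/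
private theorem sum_dite_mul (u : Fin n → ℝ) (g : Fin N → ℝ) :
    ∑ j : Fin N, (if hj : (j : ℕ) < n then u ⟨j, hj⟩ else 0) * g j = ∑ i : Fin n, u i * g (Fin.castLE h i) := by
  have hmap : ∑ i : Fin n, u i * g (Fin.castLE h i) =
      ∑ j ∈ (univ : Finset (Fin n)).map (Fin.castLEEmb h), (if hj : (j : ℕ) < n then u ⟨j, hj⟩ else 0) * g j := by
    rw [sum_map]
    refine sum_congr rfl fun i _ => ?_
    simp [Fin.castLEEmb, i.2]
  rw [hmap]
  refine (sum_subset (subset_univ _) fun j _ hj => ?_).symm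
  have hjn : ¬ (j : ℕ) < n := by
    intro hlt
    exact hj (mem_map.2 ⟨⟨j, hlt⟩, mem_univ _, by ext; simp [Fin.castLEEmb]⟩)
  simp [hjn]

/-- **Monotonicity under bordering**: for `S' ≻ 0` on `Fin N` with leading block `S = S'|_{Fin n}` (`n ≤ N`) and `v = v' ∘ castLE`,
`vᵀ S⁻¹ v ≤ v'ᵀ S'⁻¹ v'` — the explained variance grows with the subspace (extend the optimiser of §1 by zero). RH-FREE.
[folklore] -/
theorem dotProduct_inv_mulVec_submatrix_le {S' : Matrix (Fin N) (Fin N) ℝ} (hS' : S'.PosDef) (v' : Fin N → ℝ) :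
    (v' ∘ Fin.castLE h) ⬝ᵥ ((S'.submatrix (Fin.castLE h) (Fin.castLE h))⁻¹ *ᵥ (v' ∘ Fin.castLE h)) ≤
      v' ⬝ᵥ (S'⁻¹ *ᵥ v') := by
  set S : Matrix (Fin n) (Fin n) ℝ := S'.submatrix (Fin.castLE h) (Fin.castLE h) with hSdef
  set v : Fin n → ℝ := v' ∘ Fin.castLE h with hvdef
  have hS : S.PosDef := hS'.submatrix (Fin.castLE_injective h)
  set u : Fin n → ℝ := S⁻¹ *ᵥ v with hu
  set y : Fin N → ℝ := fun j => if hj : (j : ℕ) < n then u ⟨j, hj⟩ else 0 with hy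
  -- the extended optimiser reproduces the small quantities
  have hyv : y ⬝ᵥ v' = u ⬝ᵥ v := by
    simp only [dotProduct, hy]
    rw [sum_dite_mul h]
    rfl
  have hySy : y ⬝ᵥ (S' *ᵥ y) = u ⬝ᵥ (S *ᵥ u) := by
    simp only [dotProduct, mulVec, hy]
    rw [sum_dite_mul h]
    refine sum_congr rfl fun i _ => ?_
    congr 1
    have inner : ∑ k : Fin N, S' (Fin.castLE h i) k * (if hk : (k : ℕ) < n then u ⟨k, hk⟩ else 0) =
        ∑ l : Fin n, u l * S' (Fin.castLE h i) (Fin.castLE h l) := by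
      rw [← sum_dite_mul h u (fun k => S' (Fin.castLE h i) k)]
      exact sum_congr rfl fun k _ => mul_comm _ _
    rw [inner]
    exact sum_congr rfl fun l _ => by simp [hSdef, submatrix_apply, mul_comm]
  calc v ⬝ᵥ (S⁻¹ *ᵥ v) = 2 * (u ⬝ᵥ v) - u ⬝ᵥ (S *ᵥ u) := dotProduct_inv_mulVec_eq_sub hS v
    _ = 2 * (y ⬝ᵥ v') - y ⬝ᵥ (S' *ᵥ y) := by rw [hyv, hySy]
    _ ≤ v' ⬝ᵥ (S'⁻¹ *ᵥ v') := two_mul_dotProduct_sub_le hS' v' y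

end Border

/-! ## §3 THE DATA LAW (RH-FREE): `K_M(γ,γ)` is non-decreasing, `λ_M(γ)` non-increasing, in `M` -/

/-- **`λ_M(γ)` IS NON-INCREASING IN `M` (RH-FREE)**: for `n ≤ N` with `S_{N+1} ≻ 0` (then `S_{n+1} ≻ 0` too) and every real `γ`,
`K_{n+1}(γ,γ) = cᵀS_{n+1}⁻¹c + sᵀS_{n+1}⁻¹s ≤ K_{N+1}(γ,γ)`, hence `λ_{n+1}(γ) = γ²/K ≥ λ_{N+1}(γ)`. This is EM-1/EM-2's observed
monotone decrease of `λ_M(γ_k) − 1` (`1.28 → 0.437 → 0.136 → 0.0424 → 0.01255`, `M = 8…128`) as a theorem about ANY nested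
positive-definite Gram family; `S_M ≻ 0` is a kernel theorem for `M ≤ 128` (`IntegerScrewRung128.screwMatrix_posDef_of_le_127`) and
RH-equivalent for all `M`. Nothing here bears on RH. [folklore] -/
theorem christoffel_mono {n N : ℕ} (h : n ≤ N) (hS : (screwMatrix N).PosDef) (γ : ℝ) :
    (fun i : Fin n => Real.cos (γ * Real.log (((i : ℕ) + 2 : ℕ) : ℝ)) - 1) ⬝ᵥ
          ((screwMatrix n)⁻¹ *ᵥ fun i : Fin n => Real.cos (γ * Real.log (((i : ℕ) + 2 : ℕ) : ℝ)) - 1) +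
        (fun i : Fin n => Real.sin (γ * Real.log (((i : ℕ) + 2 : ℕ) : ℝ))) ⬝ᵥ
          ((screwMatrix n)⁻¹ *ᵥ fun i : Fin n => Real.sin (γ * Real.log (((i : ℕ) + 2 : ℕ) : ℝ))) ≤
      (fun i : Fin N => Real.cos (γ * Real.log (((i : ℕ) + 2 : ℕ) : ℝ)) - 1) ⬝ᵥ
          ((screwMatrix N)⁻¹ *ᵥ fun i : Fin N => Real.cos (γ * Real.log (((i : ℕ) + 2 : ℕ) : ℝ)) - 1) +
        (fun i : Fin N => Real.sin (γ * Real.log (((i : ℕ) + 2 : ℕ) : ℝ))) ⬝ᵥ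
          ((screwMatrix N)⁻¹ *ᵥ fun i : Fin N => Real.sin (γ * Real.log (((i : ℕ) + 2 : ℕ) : ℝ))) := by
  have hc := dotProduct_inv_mulVec_submatrix_le h hS
    (fun i : Fin N => Real.cos (γ * Real.log (((i : ℕ) + 2 : ℕ) : ℝ)) - 1)
  have hs := dotProduct_inv_mulVec_submatrix_le h hS
    (fun i : Fin N => Real.sin (γ * Real.log (((i : ℕ) + 2 : ℕ) : ℝ)))
  rw [screwMatrix_submatrix_castLE h] at hc hs
  have ec : ((fun i : Fin N => Real.cos (γ * Real.log (((i : ℕ) + 2 : ℕ) : ℝ)) - 1) ∘ Fin.castLE h) =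
      fun i : Fin n => Real.cos (γ * Real.log (((i : ℕ) + 2 : ℕ) : ℝ)) - 1 := by
    funext i; simp
  have es : ((fun i : Fin N => Real.sin (γ * Real.log (((i : ℕ) + 2 : ℕ) : ℝ))) ∘ Fin.castLE h) =
      fun i : Fin n => Real.sin (γ * Real.log (((i : ℕ) + 2 : ℕ) : ℝ)) := by
    funext i; simp
  rw [ec] at hc
  rw [es] at hs
  exact add_le_add hc hs

/-! ## §4 With EM-3: under RH the Christoffel readings at a zero converge (RH-CONSEQUENCE) -/

/-- **Under RH the readings `K_M(γ₀,γ₀)` increase to a limit `L ≤ γ₀²/m(ρ₀)`** (monotone by §3, bounded by EM-3's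
`christoffel_le_of_riemannHypothesis`); equivalently `λ_M(γ₀)` decreases to `γ₀²/L ≥ m(ρ₀) ≥ 1`. The hypothesis
`∀ M, S_M ≻ 0` is itself RH (`IntegerScrewPivotCriterion.riemannHypothesis_iff_screwMatrix_posDef`, not imported to stay out
of that route's cone). Whether `L = γ₀²/m(ρ₀)` is NOT claimed. RH-CONSEQUENCE; nothing here bears on the truth of RH.
[cite: Suzuki2023, (1.9) and Thm 1.2] -/
theorem christoffel_tendsto_of_riemannHypothesis (hRH : _root_.RiemannHypothesis) (hS : ∀ n, (screwMatrix n).PosDef)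
    (ρ₀ : riemannZetaNontrivialZeros) :
    ∃ L : ℝ, L ≤ (ρ₀ : ℂ).im ^ 2 / (riemannZetaZeroOrder (ρ₀ : ℂ) : ℝ) ∧
      Tendsto (fun n : ℕ =>
        (fun i : Fin n => Real.cos ((ρ₀ : ℂ).im * Real.log (((i : ℕ) + 2 : ℕ) : ℝ)) - 1) ⬝ᵥ
            ((screwMatrix n)⁻¹ *ᵥ fun i : Fin n => Real.cos ((ρ₀ : ℂ).im * Real.log (((i : ℕ) + 2 : ℕ) : ℝ)) - 1) +
          (fun i : Fin n => Real.sin ((ρ₀ : ℂ).im * Real.log (((i : ℕ) + 2 : ℕ) : ℝ))) ⬝ᵥ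
            ((screwMatrix n)⁻¹ *ᵥ fun i : Fin n => Real.sin ((ρ₀ : ℂ).im * Real.log (((i : ℕ) + 2 : ℕ) : ℝ))))
        atTop (𝓝 L) := by
  set K : ℕ → ℝ := fun n =>
    (fun i : Fin n => Real.cos ((ρ₀ : ℂ).im * Real.log (((i : ℕ) + 2 : ℕ) : ℝ)) - 1) ⬝ᵥ
        ((screwMatrix n)⁻¹ *ᵥ fun i : Fin n => Real.cos ((ρ₀ : ℂ).im * Real.log (((i : ℕ) + 2 : ℕ) : ℝ)) - 1) +
      (fun i : Fin n => Real.sin ((ρ₀ : ℂ).im * Real.log (((i : ℕ) + 2 : ℕ) : ℝ))) ⬝ᵥ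
        ((screwMatrix n)⁻¹ *ᵥ fun i : Fin n => Real.sin ((ρ₀ : ℂ).im * Real.log (((i : ℕ) + 2 : ℕ) : ℝ))) with hK
  have hmono : Monotone K := monotone_nat_of_le_succ fun n => christoffel_mono (Nat.le_succ n) (hS (n + 1)) _
  have hbdd : ∀ n, K n ≤ (ρ₀ : ℂ).im ^ 2 / (riemannZetaZeroOrder (ρ₀ : ℂ) : ℝ) := fun n =>
    christoffel_le_of_riemannHypothesis n hRH (hS n) ρ₀
  have hB : BddAbove (Set.range K) := ⟨_, by rintro _ ⟨n, rfl⟩; exact hbdd n⟩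
  refine ⟨⨆ n, K n, ciSup_le hbdd, ?_⟩
  exact tendsto_atTop_ciSup hmono hB

end Summit.RiemannHypothesis.RiemannHypothesis.Theorems.ScrewChristoffel

end
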